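import Summits.KontsevichZagierPeriods.KontsevichZagierPeriods.Theorems.EllipticMomentKernel.Negative.Targets
import Mathlib.Analysis.Calculus.Deriv.Polynomial

/-!
# `EllipticMomentKernel` (stmt-KontsevichZagierPeriods-10631) — negative knowledge, part 10: `stub_polynomialToConstant` holds for every admissible parameter

Standing-adversary certificate for the registered skeleton's stub `stub_polynomialToConstant`
(line `hermite-coordinates-hom`): it cannot be broken because it is TRUE — `[σ, Q] ~ [pt, ∫_σ Q]`
for every `Q ∈ ℚ[X]` and every rational cubic with `disc > 0`. Ingredients: a rational primitive
`R` (`exists_derivative_eq`); the value `∫_σ Q = R(e₂) − R(e₃)` (FTC transferred to `ℝ¹`,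
`integral_oval_aeval_eq`) and its algebraicity (`isAlgebraic_integral_oval_aeval`, the stub's
`∃ hA`); the legal 0-dimensional constant representation `constRep₀` (`volume univ = 1` on `ℝ⁰`);
ONE `newtonLeibnizRel` instance over the base `ℝ⁰` with the IRRATIONAL real algebraic bounds
`a = e₃`, `b = e₂` and the band `closedBandQ` of part 8 (`Targets.lean`); ONE (1a) move across the
null `endsQ`. The skeleton's `constRep _ hA` carries the same data `(univ, fun _ => ∫_σ Q)` and so
agrees with `constRep₀ _ _` by proof irrelevance. [folklore]
-/

noncomputable section

open MeasureTheory Set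
open scoped BigOperators

namespace Summit.KontsevichZagierPeriods.HermiteRigidity.EllipticMomentKernelNegative

open Literature.NumberTheory.Transcendental
open Literature.NumberTheory.Transcendental.KZ

section PolynomialToConstant

open Literature.ModelTheory.ExponentialFields (IsSemialgebraic isSemialgebraic_setOf_eval_pos
  isSemialgebraic_setOf_eval_eq_zero isSemialgebraic_univ)
open MvPolynomial (aeval X C)

variable {q₂ q₃ : ℚ}

/-- Every rational polynomial has a rational primitive. [folklore] -/
theorem exists_derivative_eq (Q : Polynomial ℚ) :
    ∃ R : Polynomial ℚ, Polynomial.derivative R = Q := by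
  induction Q using Polynomial.induction_on' with
  | add p q hp hq =>
    obtain ⟨Rp, hRp⟩ := hp
    obtain ⟨Rq, hRq⟩ := hq
    exact ⟨Rp + Rq, by rw [Polynomial.derivative_add, hRp, hRq]⟩
  | monomial n a =>
    refine ⟨Polynomial.C (a / ((n : ℚ) + 1)) * Polynomial.X ^ (n + 1), ?_⟩
    have hn : ((n : ℚ) + 1) ≠ 0 := by positivity
    rw [Polynomial.derivative_C_mul_X_pow, ← Polynomial.C_mul_X_pow_eq_monomial, Nat.add_sub_cancel]
    congr 2
    push_cast
    exact div_mul_cancel₀ a hn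

/-- **Value level**: `∫_σ Q = R(e₂) − R(e₃)` for any primitive `R` of `Q` (fundamental theorem of
calculus on `(e₃, e₂)`, transferred to `ℝ¹`). [folklore] -/
theorem integral_oval_aeval_eq {e₃ e₂ e₁ : ℝ} (h32 : e₃ < e₂) (h21 : e₂ < e₁)
    (hf : ∀ x, cubic q₂ q₃ x = 4 * (x - e₃) * (x - e₂) * (x - e₁)) {Q R : Polynomial ℚ}
    (hRQ : Polynomial.derivative R = Q) :
    ∫ p in oval q₂ q₃, (Polynomial.aeval (p 0) Q : ℝ) =
      Polynomial.aeval e₂ R - Polynomial.aeval e₃ R := by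
  have hset : oval q₂ q₃ = e1 ⁻¹' Ioo e₃ e₂ := by
    rw [oval_eq_of_roots h32 h21 hf]; ext p; simp [e1_apply]
  rw [hset]
  have h1 := measurePreserving_e1.setIntegral_preimage_emb e1.measurableEmbedding
    (fun x : ℝ => (Polynomial.aeval x Q : ℝ)) (Ioo e₃ e₂)
  simp only [e1_apply] at h1
  rw [h1, ← integral_Ioc_eq_integral_Ioo, ← intervalIntegral.integral_of_le h32.le]
  have hderiv : ∀ x ∈ uIcc e₃ e₂,
      HasDerivAt (fun x : ℝ => (Polynomial.aeval x R : ℝ)) (Polynomial.aeval x Q) x := by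
    intro x _
    have := Polynomial.hasDerivAt_aeval (R := ℚ) R x
    rwa [hRQ] at this
  have hcont : Continuous fun x : ℝ => (Polynomial.aeval x Q : ℝ) := Polynomial.continuous_aeval Q
  exact intervalIntegral.integral_eq_sub_of_hasDerivAt hderiv (hcont.intervalIntegrable _ _)

/-- **The constant of the `b`-odd branch is real algebraic**: `∫_σ Q ∈ ℚ(e₂, e₃)`. This is the
`∃ hA` of `stub_polynomialToConstant`. [folklore] -/
theorem isAlgebraic_integral_oval_aeval (h : 0 < disc q₂ q₃) (Q : Polynomial ℚ) :
    IsAlgebraic ℚ (∫ p in oval q₂ q₃, (Polynomial.aeval (p 0) Q : ℝ)) := by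
  obtain ⟨e₃, e₂, e₁, h3, h2a, h2b, h1, hf⟩ := exists_roots h
  have h32 : e₃ < e₂ := by linarith
  have h21 : e₂ < e₁ := by linarith
  obtain ⟨R, hRQ⟩ := exists_derivative_eq Q
  obtain ⟨h₃, h₂, -⟩ := cubic_roots_eq_zero hf
  rw [integral_oval_aeval_eq h32 h21 hf hRQ]
  exact isAlgebraic_aeval_sub_aeval h₃ h₂ R

/-- `ℝ⁰` has total Lebesgue mass `1` (empty product). [folklore] -/
theorem volume_univ_fin_zero : volume (univ : Set (Fin 0 → ℝ)) = 1 := by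
  rw [volume_pi, Measure.pi_univ]
  simp

/-- **The 0-dimensional constant representation `[pt, A]`** for a real algebraic `A`.
[cite: KontsevichZagier2001, §1.1] -/
def constRep₀ (A : ℝ) (hA : IsAlgebraic ℚ A) : IntegralRep 0 where
  domain := univ
  integrand := fun _ => A
  isSemialgebraic_domain := isSemialgebraic_univ
  isSemialgebraicFunOn_integrand := isSemialgebraicFunOn_const_of_isAlgebraic isSemialgebraic_univ hA
  integrableOn := integrableOn_const (by rw [volume_univ_fin_zero]; exact ENNReal.one_ne_top)

/-- Its value is `A`. [folklore] -/
theorem value_constRep₀ (A : ℝ) (hA : IsAlgebraic ℚ A) : (constRep₀ A hA).value = A := by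
  simp only [IntegralRep.value, constRep₀, Measure.restrict_univ, integral_const, smul_eq_mul]
  rw [show (volume : Measure (Fin 0 → ℝ)).real univ = 1 by
    simp [Measure.real, volume_univ_fin_zero]]
  ring

/-- `Fin.snoc` into `ℝ¹` from `ℝ⁰` (local copy of the part-5 lemma). [folklore] -/
theorem snoc_fin0_apply_zero (x : Fin 0 → ℝ) (t : ℝ) : (Fin.snoc x t : Fin 1 → ℝ) 0 = t := rfl

/-- The polynomial integrand on `ℝ¹` is continuous. [folklore] -/
theorem continuous_aeval_apply_zero (Q : Polynomial ℚ) :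
    Continuous fun p : Fin 1 → ℝ => (Polynomial.aeval (p 0) Q : ℝ) :=
  (Polynomial.continuous_aeval Q).comp (continuous_apply 0)

/-- The polynomial integrand is `ℚ`-semialgebraic on any `ℚ`-semialgebraic subset of `ℝ¹`.
[folklore] -/
theorem isSemialgebraicFunOn_aeval_apply_zero {s : Set (Fin 1 → ℝ)} (hs : IsSemialgebraic ℚ s)
    (Q : Polynomial ℚ) :
    IsSemialgebraicFunOn ℚ s (fun p => (Polynomial.aeval (p 0) Q : ℝ)) := by
  refine (isSemialgebraicFunOn_aeval hs (Polynomial.aeval (X 0 : MvPolynomial (Fin 1) ℚ) Q)).congr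
    fun p _ => ?_
  show aeval p (Polynomial.aeval (X 0 : MvPolynomial (Fin 1) ℚ) Q) = Polynomial.aeval (p 0) Q
  rw [← Polynomial.aeval_algHom_apply, MvPolynomial.aeval_X]

/-- `[closedBandQ e₃ e₂, Q]` — the band representation of the rule-3 move. [folklore] -/
def polyBandRep {e₃ e₂ e₁ : ℝ} (h32 : e₃ < e₂) (h21 : e₂ < e₁)
    (hf : ∀ x, cubic q₂ q₃ x = 4 * (x - e₃) * (x - e₂) * (x - e₁)) (Q : Polynomial ℚ) :
    IntegralRep 1 where
  domain := closedBandQ e₃ e₂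
  integrand := fun p => (Polynomial.aeval (p 0) Q : ℝ)
  isSemialgebraic_domain := isSemialgebraic_closedBandQ h32 h21 hf
  isSemialgebraicFunOn_integrand :=
    isSemialgebraicFunOn_aeval_apply_zero (isSemialgebraic_closedBandQ h32 h21 hf) Q
  integrableOn := by
    have hsub : closedBandQ e₃ e₂ ⊆ Icc (fun _ => e₃) (fun _ => e₂) := by
      rw [closedBandQ_eq]
      intro p hp
      rw [mem_Icc, Pi.le_def, Pi.le_def]
      exact ⟨fun i => by fin_cases i; exact hp.1, fun i => by fin_cases i; exact hp.2⟩
    exact ((continuous_aeval_apply_zero Q).continuousOn.integrableOn_compact isCompact_Icc).mono_set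
      hsub

/-- `[endsQ e₃ e₂, Q]` — the null piece. [folklore] -/
def polyEndsRep {e₃ e₂ e₁ : ℝ} (hf : ∀ x, cubic q₂ q₃ x = 4 * (x - e₃) * (x - e₂) * (x - e₁))
    (Q : Polynomial ℚ) : IntegralRep 1 where
  domain := endsQ e₃ e₂
  integrand := fun p => (Polynomial.aeval (p 0) Q : ℝ)
  isSemialgebraic_domain :=
    isSemialgebraic_endsQ (cubic_roots_eq_zero hf).1 (cubic_roots_eq_zero hf).2.1
  isSemialgebraicFunOn_integrand :=
    isSemialgebraicFunOn_aeval_apply_zero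
      (isSemialgebraic_endsQ (cubic_roots_eq_zero hf).1 (cubic_roots_eq_zero hf).2.1) Q
  integrableOn := by
    rw [IntegrableOn, Measure.restrict_eq_zero.2 (volume_endsQ e₃ e₂)]
    exact integrable_zero_measure

/-- **The polynomial-to-constant step is ONE legal Newton–Leibniz move over `ℝ⁰` with the
(irrational, real algebraic) bounds `a = e₃`, `b = e₂`**: `[closedBandQ, Q] − [pt, R(e₂) − R(e₃)] ∈
KZ.newtonLeibnizRel`, primitive `F = R` (`R′ = Q`). [cite: KontsevichZagier2001, §1.2 rule (3)] -/
theorem of_polyBandRep_sub_of_constRep₀_mem_newtonLeibnizRel {e₃ e₂ e₁ : ℝ} (h32 : e₃ < e₂)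
    (h21 : e₂ < e₁) (hf : ∀ x, cubic q₂ q₃ x = 4 * (x - e₃) * (x - e₂) * (x - e₁))
    {Q R : Polynomial ℚ} (hRQ : Polynomial.derivative R = Q)
    (hA : IsAlgebraic ℚ (Polynomial.aeval e₂ R - Polynomial.aeval e₃ R : ℝ)) :
    KZ.of (polyBandRep h32 h21 hf Q) - KZ.of (constRep₀ _ hA) ∈ newtonLeibnizRel := by
  obtain ⟨h₃, h₂, -⟩ := cubic_roots_eq_zero hf
  refine ⟨0, polyBandRep h32 h21 hf Q, constRep₀ _ hA, fun _ => e₃, fun _ => e₂,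
    fun z => (Polynomial.aeval (z 0) R : ℝ), ?_, isSemialgebraicFunOn_const_root h₃,
    isSemialgebraicFunOn_const_root h₂, fun _ _ => h32.le, rfl, ?_, ?_, ?_, rfl⟩
  · exact isSemialgebraicFunOn_aeval_apply_zero (isSemialgebraic_closedBandQ h32 h21 hf) R
  · intro x _
    show ContinuousOn (fun t : ℝ => (Polynomial.aeval ((Fin.snoc x t : Fin 1 → ℝ) 0) R : ℝ)) _
    simp only [snoc_fin0_apply_zero]
    exact (Polynomial.continuous_aeval R).continuousOn
  · intro x _ t _
    show HasDerivAt (fun s : ℝ => (Polynomial.aeval ((Fin.snoc x s : Fin 1 → ℝ) 0) R : ℝ))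
      (Polynomial.aeval ((Fin.snoc x t : Fin 1 → ℝ) 0) Q) t
    simp only [snoc_fin0_apply_zero]
    have := Polynomial.hasDerivAt_aeval (R := ℚ) R t
    rwa [hRQ] at this
  · intro x _
    show (Polynomial.aeval e₂ R : ℝ) - Polynomial.aeval e₃ R =
      Polynomial.aeval ((Fin.snoc x ((fun _ => e₂) x) : Fin 1 → ℝ) 0) R -
        Polynomial.aeval ((Fin.snoc x ((fun _ => e₃) x) : Fin 1 → ℝ) 0) R
    simp only [snoc_fin0_apply_zero]

/-- A representation on the null set `endsQ` is a relation. [folklore] -/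
theorem of_polyEndsRep_mem_relations {e₃ e₂ e₁ : ℝ}
    (hf : ∀ x, cubic q₂ q₃ x = 4 * (x - e₃) * (x - e₂) * (x - e₁)) (Q : Polynomial ℚ) :
    KZ.of (polyEndsRep hf Q) ∈ relations := by
  have hmem : KZ.of (polyEndsRep hf Q) - KZ.of (polyEndsRep hf Q) - KZ.of (polyEndsRep hf Q) ∈
      domainAddRel :=
    ⟨1, polyEndsRep hf Q, polyEndsRep hf Q, polyEndsRep hf Q, (union_self _).symm,
      by rw [inter_self]; exact volume_endsQ e₃ e₂, fun _ _ => rfl, fun _ _ => rfl, rfl⟩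
  have h' := domainAddRel_subset_relations hmem
  have : KZ.of (polyEndsRep hf Q) =
      -(KZ.of (polyEndsRep hf Q) - KZ.of (polyEndsRep hf Q) - KZ.of (polyEndsRep hf Q)) := by abel
  rw [this]
  exact relations.neg_mem h'

/-- **`stub_polynomialToConstant`, PROVED for every admissible parameter** (decorative `hσ` dropped;
the skeleton's `constRep _ hA` has the same data `(univ, fun _ => ∫_σ Q)` as `constRep₀`, so the two
agree by proof irrelevance): `∫_σ Q` is real algebraic and `[r] − [pt, ∫_σ Q] ∈ KZ.relations` for
every representation `r` of `[σ, Q]` — ONE (1a) move across the null `endsQ`, `[endsQ] ~ 0`, and the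
rule-3 move `of_polyBandRep_sub_of_constRep₀_mem_newtonLeibnizRel`.
[cite: KontsevichZagier2001, §1.2 rules (1) and (3)] -/
theorem polynomialToConstant (h : 0 < disc q₂ q₃) (Q : Polynomial ℚ) :
    ∃ hA : IsAlgebraic ℚ (∫ p in oval q₂ q₃, (Polynomial.aeval (p 0) Q : ℝ)),
      ∀ r : IntegralRep 1, r.domain = oval q₂ q₃ →
        EqOn r.integrand (fun p => (Polynomial.aeval (p 0) Q : ℝ)) (oval q₂ q₃) →
        KZ.of r - KZ.of (constRep₀ _ hA) ∈ relations := by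
  refine ⟨isAlgebraic_integral_oval_aeval h Q, fun r hr hri => ?_⟩
  obtain ⟨e₃, e₂, e₁, h3, h2a, h2b, h1, hf⟩ := exists_roots h
  have h32 : e₃ < e₂ := by linarith
  have h21 : e₂ < e₁ := by linarith
  obtain ⟨R, hRQ⟩ := exists_derivative_eq Q
  obtain ⟨h₃, h₂, -⟩ := cubic_roots_eq_zero hf
  have hval := integral_oval_aeval_eq h32 h21 hf hRQ
  have hA' : IsAlgebraic ℚ (Polynomial.aeval e₂ R - Polynomial.aeval e₃ R : ℝ) :=
    isAlgebraic_aeval_sub_aeval h₃ h₂ R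
  -- the constant representation of the stub IS `constRep₀ (R(e₂) − R(e₃))`
  have hc : constRep₀ _ (isAlgebraic_integral_oval_aeval h Q) = constRep₀ _ hA' := by
    simp only [constRep₀, hval]
  rw [hc]
  -- the (1a) move
  have h1a : KZ.of (polyBandRep h32 h21 hf Q) - KZ.of r - KZ.of (polyEndsRep hf Q) ∈
      domainAddRel := by
    refine ⟨1, polyBandRep h32 h21 hf Q, r, polyEndsRep hf Q, ?_, ?_, ?_, fun _ _ => rfl, rfl⟩
    · show closedBandQ e₃ e₂ = r.domain ∪ endsQ e₃ e₂
      rw [hr, closedBandQ_eq_union h32 h21 hf]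
    · show volume (r.domain ∩ endsQ e₃ e₂) = 0
      rw [hr, oval_inter_endsQ h32 h21 hf, measure_empty]
    · intro z hz
      rw [hr] at hz
      exact (hri hz).symm
  have hAr := domainAddRel_subset_relations h1a
  have hB := of_polyEndsRep_mem_relations hf Q
  have hC := newtonLeibnizRel_subset_relations
    (of_polyBandRep_sub_of_constRep₀_mem_newtonLeibnizRel h32 h21 hf hRQ hA')
  have : KZ.of r - KZ.of (constRep₀ _ hA') =
      (KZ.of (polyBandRep h32 h21 hf Q) - KZ.of (constRep₀ _ hA')) -
        (KZ.of (polyBandRep h32 h21 hf Q) - KZ.of r - KZ.of (polyEndsRep hf Q)) -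
        KZ.of (polyEndsRep hf Q) := by
    abel
  rw [this]
  exact relations.sub_mem (relations.sub_mem hC hAr) hB

/-- The value bookkeeping behind it: `value [pt, ∫_σ Q] = ∫_σ Q = value [σ, Q]`. [folklore] -/
theorem value_constRep₀_integral (h : 0 < disc q₂ q₃) (Q : Polynomial ℚ) :
    (constRep₀ _ (isAlgebraic_integral_oval_aeval h Q)).value =
      ∫ p in oval q₂ q₃, (Polynomial.aeval (p 0) Q : ℝ) :=
  value_constRep₀ _ _

end PolynomialToConstant

end Summit.KontsevichZagierPeriods.HermiteRigidity.EllipticMomentKernelNegative
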